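import Summits.AnomalousDissipation.AnomalousDissipation.Theses.MarginalStabilityChain
import Literature.Analysis.FluidPDE.StretchedLayerNS
import HarnessLib

/-!
# Crux `MarginalStabilityChain.StrainedLayerLaw` (stmt-AnomalousDissipation-3007): objects and glue of the line
`contraction-capture`

Definitions-only support file plus SORRY-FREE glue, so that the line's REGISTERED STUBS — landed one by one as
`--supports stmt-AnomalousDissipation-3007` files under `Theorems/` — and the lead's checked skeleton
(`Cruxes/StrainedLayerLaw/Lines/contraction_capture.lean`, a crux workfile, not importable) speak about the SAME
declarations (lead `prover-line-stmt-AnomalousDissipation-3007-0`, 2026-08-16). Contents: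

* §0 the crux's vocabulary VERBATIM: `InClass ν L θ₁ θ₂ u v p` (the hypothesis list of `StrainedLayerLaw` on a
  solution `(u, v, p)` at viscosity `ν`, period `L`, datum `U_B^ν + θ`, character for character, so that the crux's
  hypothesis and `InClass` agree by `rfl`) and `IsAdmissiblePerturbation L θ₁ θ₂` (the five `θ`-clauses);
* §1 vorticity bookkeeping of a time slice: `vort`, `boxCirc` (box circulation), `cellPosVort`, `cellAbsVortOutside`,
  `IsCaptured` (coarse capture at scale `r` with tolerance `ε`);
* §2 glue (proved): `isAdmissiblePerturbation_nat_mul`, `InClass.contDiff_slices`, `InClass.periodic_slices`,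
  `finePeriod_bounds` (fine-period arithmetic `n = ⌈L/L₀⌉₊`, `ℓ = L/n`);
* §3 the CONDITIONAL composition `StrainedLayerLaw_of_stubs` (sorry-free): its five hypotheses are, verbatim, the
  statements of the five registered stubs (`stub_velocityRigidity`, `stub_pressureRenormalisation`, `stub_coarseCapture`,
  `stub_viscousCore`, `stub_coreFloor`; `ledger skeleton check`, 2026-08-16) and its conclusion is the crux BY NAME.

The stubs themselves live in the skeleton / the stub files, not here; no facts are asserted in this file. Statements are verbatim those of the planner's checked skeleton
(planner-cruxplan-stmt-AnomalousDissipation-3007-contraction-capture-0) as reshaped by the lead (reshape 1).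

References: the route file `Theses/MarginalStabilityChain.lean` (item 3007); `Literature/Analysis/FluidPDE/StretchedLayerNS.lean`
(`StretchedLayer.dX/dY`, `layerDissipation`, `meanLayerDissipation`); the line card
`Cruxes/StrainedLayerLaw/Lines/contraction-capture.md`; Majda–Bertozzi 2002 §1.4 (the stretched 2-D class).
-/

-- `Summit.<Summit>.<Problem>` is the tree's mandated summit-side namespace (CONVENTIONS §2); for this
-- single-conjunct summit the two coincide, so the duplicate is deliberate.
set_option linter.dupNamespace false

noncomputable section

open scoped BigOperators Topology ENNReal
open Filter Set Function MeasureTheory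

namespace Summit.AnomalousDissipation.AnomalousDissipation.Theorems.StrainedLayerLaw.ContractionCapture

open Literature.Analysis.FluidPDE Literature.Analysis.FluidPDE.StretchedLayer
open Summit.AnomalousDissipation.AnomalousDissipation.Theses.MarginalStabilityChain

/-! ## §0 The crux's vocabulary, verbatim -/

/-- **The crux's solution class, verbatim** (`γ = ΔU = 1`, period `L`, datum `U_B^ν + θ`): `u, v ∈ C²`, `p ∈ C¹` on `t > 0`,
`u, v` continuous up to `t = 0`, the stretched 2-D Navier–Stokes system pointwise for `t > 0`, all three fields `L`-periodic in `x`
for `t ≥ 0`, pointwise shear far field for `t ≥ 0`, data `U_B^ν + θ₁`, `θ₂`. Character-for-character the hypothesis list of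
`MarginalStabilityChain.StrainedLayerLaw` (so `InClass ν L θ₁ θ₂ u v p` and the crux's hypothesis agree by `rfl`). [folklore] -/
def InClass (ν L : ℝ) (θ₁ θ₂ : ℝ → ℝ → ℝ) (u v p : ℝ → ℝ → ℝ → ℝ) : Prop :=
  let Dt : (ℝ → ℝ → ℝ → ℝ) → ℝ → ℝ → ℝ → ℝ := fun f t x y => deriv (fun s => f s x y) t
  let Dx : (ℝ → ℝ → ℝ → ℝ) → ℝ → ℝ → ℝ → ℝ := fun f t x y => deriv (fun s => f t s y) x
  let Dy : (ℝ → ℝ → ℝ → ℝ) → ℝ → ℝ → ℝ → ℝ := fun f t x y => deriv (fun s => f t x s) y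
  let UB : ℝ → ℝ := fun y => (Real.sqrt (2 * Real.pi * ν))⁻¹ * ∫ s in (0:ℝ)..y, Real.exp (-(s ^ 2) / (2 * ν))
  ContDiffOn ℝ 2 (fun q : ℝ × ℝ × ℝ => u q.1 q.2.1 q.2.2) (Set.Ioi 0 ×ˢ Set.univ) ∧
  ContDiffOn ℝ 2 (fun q : ℝ × ℝ × ℝ => v q.1 q.2.1 q.2.2) (Set.Ioi 0 ×ˢ Set.univ) ∧
  ContDiffOn ℝ 1 (fun q : ℝ × ℝ × ℝ => p q.1 q.2.1 q.2.2) (Set.Ioi 0 ×ˢ Set.univ) ∧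
  ContinuousOn (fun q : ℝ × ℝ × ℝ => u q.1 q.2.1 q.2.2) (Set.Ici 0 ×ˢ Set.univ) ∧
  ContinuousOn (fun q : ℝ × ℝ × ℝ => v q.1 q.2.1 q.2.2) (Set.Ici 0 ×ˢ Set.univ) ∧
  (∀ t x y, 0 < t → Dt u t x y + u t x y * Dx u t x y + (v t x y - y) * Dy u t x y = -Dx p t x y + ν * (Dx (Dx u) t x y + Dy (Dy u) t x y) ∧ Dt v t x y + u t x y * Dx v t x y + (v t x y - y) * Dy v t x y - v t x y = -Dy p t x y + ν * (Dx (Dx v) t x y + Dy (Dy v) t x y) ∧ Dx u t x y + Dy v t x y = 0) ∧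
  (∀ t x y, 0 ≤ t → u t (x + L) y = u t x y ∧ v t (x + L) y = v t x y ∧ p t (x + L) y = p t x y) ∧
  (∀ t x, 0 ≤ t → Tendsto (fun y => u t x y) atTop (nhds (1 / 2)) ∧ Tendsto (fun y => u t x y) atBot (nhds (-(1 / 2))) ∧ Tendsto (fun y => v t x y) atTop (nhds 0) ∧ Tendsto (fun y => v t x y) atBot (nhds 0)) ∧
  (∀ x y, u 0 x y = UB y + θ₁ x y ∧ v 0 x y = θ₂ x y)

/-- **Admissible perturbations of period `L`, verbatim** (the five `θ`-clauses of the crux): `θ₁, θ₂ ∈ C²(ℝ²)`, `L`-periodic in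
`x`, vanishing for `|y| ≥ R`, and `∂ₓθ₁ + ∂_yθ₂ = 0`. (Periodicity + compact support force ZERO net circulation of `ω_θ` per period:
`∫∫(∂ₓθ₂ − ∂_yθ₁) = 0` — the reason a seeded core must be SHIELDED and only the net `−ℓ` can be banked.) [folklore] -/
def IsAdmissiblePerturbation (L : ℝ) (θ₁ θ₂ : ℝ → ℝ → ℝ) : Prop :=
  ContDiff ℝ 2 (fun q : ℝ × ℝ => θ₁ q.1 q.2) ∧ ContDiff ℝ 2 (fun q : ℝ × ℝ => θ₂ q.1 q.2) ∧
  (∀ x y, θ₁ (x + L) y = θ₁ x y ∧ θ₂ (x + L) y = θ₂ x y) ∧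
  (∃ R : ℝ, ∀ x y, R ≤ |y| → θ₁ x y = 0 ∧ θ₂ x y = 0) ∧
  (∀ x y, deriv (fun s => θ₁ s y) x + deriv (fun s => θ₂ x s) y = 0)

/-! ## §1 Vorticity bookkeeping of a time slice: box circulation, cell masses, coarse capture -/

/-- Vorticity `ω = ∂ₓv − ∂_yu` of a slice `(u, v) = (f, g)` (slice derivatives `dX`, `dY` of `StretchedLayerNS`, i.e. Mathlib
`deriv` of the partial maps — the crux's `Dx`, `Dy`). The layer's vorticity is NEGATIVE (`−U_B′`), circulation `−ℓ` per period.
[folklore] -/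
def vort (f g : ℝ → ℝ → ℝ) (x y : ℝ) : ℝ :=
  dX g x y - dY f x y

/-- **Box circulation** `Γ_Q = ∫_{x ∈ [a−ρ, a+ρ]} ∫_{y ∈ [b−ρ, b+ρ]} ω` of the slice `(f, g)` over the closed box `Q` of half-side
`ρ` centred at `(a, b)` (iterated Bochner integrals, matching the iterated structure of `layerDissipation`; junk `0` if not
integrable). A box rather than a disc: area `4ρ²` enters the transfer constant, nothing else changes. [folklore] -/
def boxCirc (f g : ℝ → ℝ → ℝ) (a b ρ : ℝ) : ℝ :=
  ∫ x in Set.Icc (a - ρ) (a + ρ), ∫ y in Set.Icc (b - ρ) (b + ρ), vort f g x y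

/-- **Positive-vorticity mass of one period cell** (window of length `ℓ` centred at `x = a`):
`∫⁻_{x ∈ (a−ℓ/2, a+ℓ/2]} ∫⁻_y ofReal ω` — `ofReal` clips `ω < 0` to `0`, so this is `∫∫_cell ω₊ ∈ [0, ∞]` (no integrability
presupposed). Along physical solutions it is NON-INCREASING in time (conservation form `∂ₜω + div(ω(u, v−y)) = νΔω`, Kato): the
line's sign budget. [folklore] -/
def cellPosVort (ℓ : ℝ) (f g : ℝ → ℝ → ℝ) (a : ℝ) : ℝ≥0∞ :=
  ∫⁻ x in Set.Ioc (a - ℓ / 2) (a + ℓ / 2), ∫⁻ y, ENNReal.ofReal (vort f g x y)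

/-- **`|ω|`-mass of one period cell OUTSIDE the box** of half-side `r` centred at `(a, b)` (cell window centred at the same `a`,
so for `r ≤ ℓ/2` the box does not wrap around): `∫⁻_{x ∈ (a−ℓ/2, a+ℓ/2]} ∫⁻_y 𝟙_{Qᶜ} ofReal |ω| ∈ [0, ∞]`. [folklore] -/
def cellAbsVortOutside (ℓ : ℝ) (f g : ℝ → ℝ → ℝ) (a b r : ℝ) : ℝ≥0∞ :=
  ∫⁻ x in Set.Ioc (a - ℓ / 2) (a + ℓ / 2), ∫⁻ y,
    (Set.Icc (a - r) (a + r) ×ˢ Set.Icc (b - r) (b + r))ᶜ.indicator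
      (fun q : ℝ × ℝ => ENNReal.ofReal |vort f g q.1 q.2|) (x, y)

/-- **Coarse capture** of a slice `(f, g)` in a cell of period `ℓ`, tolerance `ε`, radius `r`: there is ONE centre `(a, b)` with
`|b| ≤ r` (near the axis — the translation mode is slaved, `d/dt ∫∫yω = −∫∫yω`) such that the box of half-side `r` about it carries
circulation `−ℓ` up to `εℓ` (the whole cell's: `∫∫_cell ω = −∫₀^ℓ [u]_{y=−∞}^{+∞} dx = −ℓ` by the far field and periodicity), all
but `εℓ` of the cell's `|ω|`-mass lies in that box, and the cell's positive (wrong-signed) vorticity mass is `≤ εℓ`. Says WHERE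
the circulation is at scale `r ≍ ℓ`; says nothing at the viscous scale; every clause is local or a cell mass, so the inner stub
needs no far-field bookkeeping. (The laminar Burgers layer is never captured for `r < (1 − 2ε)ℓ/2`: its mass is spread uniformly
in `x`.) [folklore] -/
def IsCaptured (ℓ ε r : ℝ) (f g : ℝ → ℝ → ℝ) : Prop :=
  ∃ a b : ℝ, |b| ≤ r ∧ |boxCirc f g a b r + ℓ| ≤ ε * ℓ ∧
    cellAbsVortOutside ℓ f g a b r ≤ ENNReal.ofReal (ε * ℓ) ∧ cellPosVort ℓ f g a ≤ ENNReal.ofReal (ε * ℓ)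


/-! ## §2 Glue (sorry-free) -/

/-- An `ℓ`-periodic admissible perturbation is admissible for every multiple period `nℓ`. [folklore] -/
theorem isAdmissiblePerturbation_nat_mul {ℓ : ℝ} {θ₁ θ₂ : ℝ → ℝ → ℝ} (h : IsAdmissiblePerturbation ℓ θ₁ θ₂)
    (n : ℕ) : IsAdmissiblePerturbation (n * ℓ) θ₁ θ₂ := by
  obtain ⟨h1, h2, hper, hsupp, hdiv⟩ := h
  refine ⟨h1, h2, fun x y => ?_, hsupp, hdiv⟩
  have p1 : Function.Periodic (fun s => θ₁ s y) ℓ := fun s => (hper s y).1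
  have p2 : Function.Periodic (fun s => θ₂ s y) ℓ := fun s => (hper s y).2
  exact ⟨p1.nat_mul n x, p2.nat_mul n x⟩

/-- Slices of a class solution are `C²` for `t > 0`. [folklore] -/
theorem InClass.contDiff_slices {ν L : ℝ} {θ₁ θ₂ : ℝ → ℝ → ℝ} {u v p : ℝ → ℝ → ℝ → ℝ}
    (h : InClass ν L θ₁ θ₂ u v p) {t : ℝ} (ht : 0 < t) :
    ContDiff ℝ 2 (fun q : ℝ × ℝ => u t q.1 q.2) ∧ ContDiff ℝ 2 (fun q : ℝ × ℝ => v t q.1 q.2) :=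
  ⟨contDiff_slice h.1 (Set.mem_Ioi.2 ht), contDiff_slice h.2.1 (Set.mem_Ioi.2 ht)⟩

/-- Slices of a class solution with period `L` are `L`-periodic in `x` for `t > 0`. [folklore] -/
theorem InClass.periodic_slices {ν L : ℝ} {θ₁ θ₂ : ℝ → ℝ → ℝ} {u v p : ℝ → ℝ → ℝ → ℝ}
    (h : InClass ν L θ₁ θ₂ u v p) (t x y : ℝ) (ht : 0 < t) :
    u t (x + L) y = u t x y ∧ v t (x + L) y = v t x y :=
  ⟨(h.2.2.2.2.2.2.1 t x y ht.le).1, (h.2.2.2.2.2.2.1 t x y ht.le).2.1⟩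

/-- Fine-period arithmetic: for `0 < L₀ ≤ 1`, `0 < L` and `n = ⌈L/L₀⌉₊`, the period `ℓ = L/n` satisfies `1 ≤ n`, `0 < ℓ ≤ L₀`,
`n·ℓ = L` and `min(L,1)·L₀/2 ≤ ℓ`. [folklore] -/
theorem finePeriod_bounds {L L₀ : ℝ} (hL : 0 < L) (hL₀ : 0 < L₀) (hL₀1 : L₀ ≤ 1) :
    1 ≤ ⌈L / L₀⌉₊ ∧ 0 < L / ⌈L / L₀⌉₊ ∧ L / ⌈L / L₀⌉₊ ≤ L₀ ∧ (⌈L / L₀⌉₊ : ℝ) * (L / ⌈L / L₀⌉₊) = L ∧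
      min L 1 * L₀ / 2 ≤ L / ⌈L / L₀⌉₊ := by
  have hq : 0 < L / L₀ := div_pos hL hL₀
  have hn : 1 ≤ ⌈L / L₀⌉₊ := Nat.one_le_iff_ne_zero.2 (Nat.pos_iff_ne_zero.1 (Nat.ceil_pos.2 hq))
  have hnR : (1 : ℝ) ≤ (⌈L / L₀⌉₊ : ℝ) := by exact_mod_cast hn
  have hn0 : (0 : ℝ) < (⌈L / L₀⌉₊ : ℝ) := by linarith
  have hle : L / L₀ ≤ (⌈L / L₀⌉₊ : ℝ) := Nat.le_ceil _
  have hlt : (⌈L / L₀⌉₊ : ℝ) < L / L₀ + 1 := Nat.ceil_lt_add_one hq.le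
  refine ⟨hn, div_pos hL hn0, ?_, ?_, ?_⟩
  · rw [div_le_iff₀ hn0]
    rw [div_le_iff₀ hL₀] at hle
    linarith [mul_comm L₀ (⌈L / L₀⌉₊ : ℝ)]
  · rw [← mul_div_assoc, mul_div_cancel_left₀ L hn0.ne']
  · -- `ℓ = L/n > L/(L/L₀ + 1) = L L₀/(L + L₀) ≥ min(L,1) L₀ / 2`
    have h1 : L / (L / L₀ + 1) < L / ⌈L / L₀⌉₊ := div_lt_div_of_pos_left hL hn0 hlt
    have h2 : min L 1 * L₀ / 2 ≤ L / (L / L₀ + 1) := by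
      rw [le_div_iff₀ (by positivity)]
      have hm1 : min L 1 ≤ 1 := min_le_right _ _
      have hmL : min L 1 ≤ L := min_le_left _ _
      have hm0 : 0 ≤ min L 1 := le_min hL.le zero_le_one
      -- `min(L,1)·L₀/2·(L/L₀ + 1) = min(L,1)·(L + L₀)/2 ≤ (L + L·L₀... )` : use `min ≤ 1`, `min ≤ L`, `L₀ ≤ 1`
      have : min L 1 * L₀ / 2 * (L / L₀ + 1) = (min L 1 * L + min L 1 * L₀) / 2 := by
        field_simp
      rw [this]
      nlinarith [mul_le_mul_of_nonneg_right hm1 hL.le, mul_le_mul_of_nonneg_left hL₀1 hm0,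
        mul_le_mul_of_nonneg_right hmL hL₀.le]
    exact h2.trans h1.le


/-! ## §3 The CONDITIONAL composition (sorry-free): the five registered stub statements prove the crux BY NAME -/

/-- **Conditional composition (kernel-checked, sorry-free): the five stub statements prove the crux BY NAME.**
`ViscousCore` gives absolute `ε, ρ₀, κ`; `CoarseCapture ε` gives `L₀ ≤ 1`; take `c := κ²L₀/(16ρ₀²)`. For `L > 0` let
`n := ⌈L/L₀⌉₊`, `ℓ := L/n` (`finePeriod_bounds`); the seed `θ_ℓ` is admissible with period `L = nℓ`; with
`ν₀ := min (min ν₀(ℓ) ν₁(ℓ)) (ℓ²/(4ρ₀²))`, a crux solution at period `L` is `InClass ν (nℓ) θ_ℓ u v p` (definitionally), drops to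
period `ℓ` (rigidity + pressure renormalisation), is captured, concentrates, and `CoreFloor` (with `ρ = ρ₀√ν`, `Γ₀ = κℓ`) gives
`meanLayerDissipation ν L u v ≥ κ²ℓ/(8ρ₀²) ≥ c·min(L,1)` — the crux's conclusion up to unfolding. -/
theorem StrainedLayerLaw_of_stubs
    (h1a : ∀ {ν ℓ : ℝ} {n : ℕ} {θ₁ θ₂ : ℝ → ℝ → ℝ} {u v p : ℝ → ℝ → ℝ → ℝ},
        0 < ν → 0 < ℓ → 1 ≤ n → IsAdmissiblePerturbation ℓ θ₁ θ₂ → InClass ν (n * ℓ) θ₁ θ₂ u v p →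
          ∀ t x y : ℝ, 0 ≤ t → u t (x + ℓ) y = u t x y ∧ v t (x + ℓ) y = v t x y)
    (h1b : ∀ {ν ℓ : ℝ} {n : ℕ} {θ₁ θ₂ : ℝ → ℝ → ℝ} {u v p : ℝ → ℝ → ℝ → ℝ},
        1 ≤ n → InClass ν (n * ℓ) θ₁ θ₂ u v p →
          (∀ t x y : ℝ, 0 ≤ t → u t (x + ℓ) y = u t x y ∧ v t (x + ℓ) y = v t x y) →
            ∃ p' : ℝ → ℝ → ℝ → ℝ, InClass ν ℓ θ₁ θ₂ u v p')
    (h2 : ∀ ε : ℝ, 0 < ε →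
        ∃ L₀ : ℝ, 0 < L₀ ∧ L₀ ≤ 1 ∧ ∀ ℓ : ℝ, 0 < ℓ → ℓ ≤ L₀ →
          ∃ θ₁ θ₂ : ℝ → ℝ → ℝ, IsAdmissiblePerturbation ℓ θ₁ θ₂ ∧ ∃ ν₀ : ℝ, 0 < ν₀ ∧
            ∀ ν : ℝ, 0 < ν → ν ≤ ν₀ → ∀ u v p : ℝ → ℝ → ℝ → ℝ, InClass ν ℓ θ₁ θ₂ u v p →
              ∃ T₁ : ℝ, ∀ t : ℝ, T₁ ≤ t → IsCaptured ℓ ε (ℓ / 4) (u t) (v t))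
    (h3 : ∃ ε ρ₀ κ : ℝ, 0 < ε ∧ 0 < ρ₀ ∧ 0 < κ ∧ ∀ ℓ : ℝ, 0 < ℓ → ℓ ≤ 1 → ∃ ν₁ : ℝ, 0 < ν₁ ∧
        ∀ ν : ℝ, 0 < ν → ν ≤ ν₁ → ∀ (θ₁ θ₂ : ℝ → ℝ → ℝ) (u v p : ℝ → ℝ → ℝ → ℝ),
          IsAdmissiblePerturbation ℓ θ₁ θ₂ → InClass ν ℓ θ₁ θ₂ u v p →
          ∀ T₁ : ℝ, (∀ t : ℝ, T₁ ≤ t → IsCaptured ℓ ε (ℓ / 4) (u t) (v t)) →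
            ∃ T₂ : ℝ, 0 < T₂ ∧ ∀ t : ℝ, T₂ ≤ t →
              ∃ a b : ℝ, κ * ℓ ≤ |boxCirc (u t) (v t) a b (ρ₀ * Real.sqrt ν)|)
    (h4 : ∀ {ν ℓ ρ Γ₀ T₂ : ℝ} {n : ℕ} {u v : ℝ → ℝ → ℝ → ℝ},
        0 < ν → 0 < ℓ → 1 ≤ n → 0 < ρ → 2 * ρ ≤ ℓ → 0 ≤ Γ₀ → 0 < T₂ →
        (∀ t : ℝ, 0 < t →
          ContDiff ℝ 2 (fun q : ℝ × ℝ => u t q.1 q.2) ∧ ContDiff ℝ 2 (fun q : ℝ × ℝ => v t q.1 q.2)) →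
        (∀ t x y : ℝ, 0 < t → u t (x + ℓ) y = u t x y ∧ v t (x + ℓ) y = v t x y) →
        (∀ t : ℝ, T₂ ≤ t → ∃ a b : ℝ, Γ₀ ≤ |boxCirc (u t) (v t) a b ρ|) →
          ENNReal.ofReal (ν * Γ₀ ^ 2 / (8 * ρ ^ 2 * ℓ)) ≤ meanLayerDissipation ν (n * ℓ) u v) :
    StrainedLayerLaw := by
  obtain ⟨ε, ρ₀, κ, hε, hρ₀, hκ, hcore⟩ := h3
  obtain ⟨L₀, hL₀, hL₀1, hcap⟩ := h2 ε hε
  refine ⟨κ ^ 2 * L₀ / (16 * ρ₀ ^ 2), by positivity, fun L hL => ?_⟩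
  obtain ⟨hn, hℓ, hℓL₀, hnℓ, hℓlow⟩ := finePeriod_bounds hL hL₀ hL₀1
  set n : ℕ := ⌈L / L₀⌉₊ with hn_def
  set ℓ : ℝ := L / n with hℓ_def
  obtain ⟨θ₁, θ₂, hadm, ν₀, hν₀, hsol⟩ := hcap ℓ hℓ hℓL₀
  obtain ⟨ν₁, hν₁, hcon⟩ := hcore ℓ hℓ (hℓL₀.trans hL₀1)
  have hadmL : IsAdmissiblePerturbation L θ₁ θ₂ := by
    simpa only [hnℓ] using isAdmissiblePerturbation_nat_mul hadm n
  obtain ⟨hC1, hC2, hperL, hsupp, hdiv⟩ := hadmL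
  refine ⟨min (min ν₀ ν₁) (ℓ ^ 2 / (4 * ρ₀ ^ 2)), by positivity, θ₁, θ₂, hC1, hC2, hperL, hsupp, hdiv, ?_⟩
  intro ν hν hνle u v p Dt Dx Dy UB D hclass
  -- the crux's hypothesis list at period `L` IS `InClass ν L θ₁ θ₂ u v p`
  have hIn : InClass ν ((n : ℝ) * ℓ) θ₁ θ₂ u v p := by
    rw [hnℓ]
    exact hclass
  have hν₀' : ν ≤ ν₀ := hνle.trans ((min_le_left _ _).trans (min_le_left _ _))
  have hν₁' : ν ≤ ν₁ := hνle.trans ((min_le_left _ _).trans (min_le_right _ _))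
  have hνρ : ν ≤ ℓ ^ 2 / (4 * ρ₀ ^ 2) := hνle.trans (min_le_right _ _)
  -- rigidity: drop to the seed's period
  obtain ⟨p', hIn'⟩ := h1b hn hIn (h1a hν hℓ hn hadm hIn)
  -- outer: coarse capture for all late times
  obtain ⟨T₁, hT₁⟩ := hsol ν hν hν₀' u v p' hIn'
  -- inner: viscous-scale core for all late times
  obtain ⟨T₂, hT₂, hbox⟩ := hcon ν hν hν₁' θ₁ θ₂ u v p' hadm hIn' T₁ hT₁
  -- transfer
  have hρ : 0 < ρ₀ * Real.sqrt ν := mul_pos hρ₀ (Real.sqrt_pos.2 hν)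
  have hρℓ : 2 * (ρ₀ * Real.sqrt ν) ≤ ℓ := by
    have hs : Real.sqrt ν ≤ Real.sqrt (ℓ ^ 2 / (4 * ρ₀ ^ 2)) := Real.sqrt_le_sqrt hνρ
    have heq : Real.sqrt (ℓ ^ 2 / (4 * ρ₀ ^ 2)) = ℓ / (2 * ρ₀) := by
      rw [show ℓ ^ 2 / (4 * ρ₀ ^ 2) = (ℓ / (2 * ρ₀)) ^ 2 by field_simp; ring]
      exact Real.sqrt_sq (by positivity)
    rw [heq] at hs
    calc 2 * (ρ₀ * Real.sqrt ν) ≤ 2 * (ρ₀ * (ℓ / (2 * ρ₀))) := by gcongr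
      _ = ℓ := by field_simp
  have hfloor := h4 (n := n) hν hℓ hn hρ hρℓ (by positivity : 0 ≤ κ * ℓ) hT₂
    (fun t ht => hIn'.contDiff_slices ht) (fun t x y ht => hIn'.periodic_slices t x y ht) hbox
  -- constants: `ν (κℓ)² / (8 (ρ₀√ν)² ℓ) = κ²ℓ/(8ρ₀²) ≥ κ²L₀/(16ρ₀²) · min L 1`
  have hconst : ν * (κ * ℓ) ^ 2 / (8 * (ρ₀ * Real.sqrt ν) ^ 2 * ℓ) = κ ^ 2 * ℓ / (8 * ρ₀ ^ 2) := by
    rw [mul_pow ρ₀, Real.sq_sqrt hν.le]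
    field_simp
  have hcmp : κ ^ 2 * L₀ / (16 * ρ₀ ^ 2) * min L 1 ≤ κ ^ 2 * ℓ / (8 * ρ₀ ^ 2) := by
    have : κ ^ 2 * L₀ / (16 * ρ₀ ^ 2) * min L 1 = κ ^ 2 / (8 * ρ₀ ^ 2) * (min L 1 * L₀ / 2) := by ring
    rw [this, show κ ^ 2 * ℓ / (8 * ρ₀ ^ 2) = κ ^ 2 / (8 * ρ₀ ^ 2) * ℓ by ring]
    exact mul_le_mul_of_nonneg_left hℓlow (by positivity)
  rw [hconst, hnℓ] at hfloor
  change ENNReal.ofReal (κ ^ 2 * L₀ / (16 * ρ₀ ^ 2) * min L 1) ≤ meanLayerDissipation ν L u v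
  exact (ENNReal.ofReal_le_ofReal hcmp).trans hfloor

end Summit.AnomalousDissipation.AnomalousDissipation.Theorems.StrainedLayerLaw.ContractionCapture

end
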